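import Mathlib
import Literature.Analysis.FluidPDE.Tao2016AveragedNS.ShiftSetCascadeFlows
import Summits.NavierStokesRegularity.NavierStokesRegularity.Theorems.TaoLadderRungTwoFlatCertificateGlueTruncFlowPerCompOn
import Summits.NavierStokesRegularity.NavierStokesRegularity.Theorems.TaoLadderRungTwoFlatCertificateGlueLohnerStepOn
import Summits.NavierStokesRegularity.NavierStokesRegularity.Theorems.TaoLadderRungTwoFlatCertificateGlueLohnerApproxOn
import HarnessLib

/-!
# Certificate glue on a shift set `𝕊`, XIX-c: THE LOHNER STEP WITH PER-COMPONENT WEIGHTS — `StepCert` from a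
  Lohner-chain certificate step whose parallelepiped node sets, (B)-table, majorant hull, region and Grönwall
  allowance all live in the per-component weighted coordinates `x_{ic} = z i k_c / ω i k_c`
  (helper for items stmt-NavierStokesRegularity-22987 `FlatGapCertificatesV2` (crux K_A♭ of route TaoLadderRungTwoFlat)
  and stmt-24295 K_A₂(64); cell harvest/h2-tao-ladder, p1 g15; theory-1 ruling R6a, bus l.494)

theory-1's kernel-Lohner feasibility desk (NUM-T41f, bus l.494) found that the scalar-`E` Lohner step of glue XVIII/XIX
closes on the engine's own hop-9 grid at the engine's order IF the weight table follows the radius profile PER COMPONENT,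
and does not with per-shell weights. This module is glue XIX (`stepCert_of_lohner`) and XIX-b
(`stepCert_of_lohner_approx`) with `ω : Fin m → ℤ → ℝ` throughout — `pxcoord`, `PInPara`, the (B)-table
`Σ |α| c ω̂_{i₁}(a) ω̂_{i₂}(b) ≤ b·ω i k` (glue XVI-c `pqcN_bound_of_table`), the majorant hull `|y i k| ≤ (R_h + A) ω i k`,
the region `|y i k| ≤ R ω i k`, the input defect `δ·ω i k` and the allowance `A·ω i k` (glue XIV-c `stepCert_of_flowTube`);
glue XVIII (the abstract Lohner node step on `Fin n → ℝ`) is untouched.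

HONEST FRAMING: Tao-type MODEL lattices (Tao 2016 §4/§6 vocabulary, shift-set parametrised); every clause is a
HYPOTHESIS — nothing is computed or certified here, no stub is closed, nothing about the Navier–Stokes equations.
-/

noncomputable section

-- the sub-problem namespace repeats the summit name by design (D-0017)
set_option linter.dupNamespace false

namespace Summit.NavierStokesRegularity.NavierStokesRegularity.Theorems

open Set Finset Literature.Analysis.FluidPDE Literature.Analysis.FluidPDE.TaoCascade
open Summit.NavierStokesRegularity.NavierStokesRegularity.Theorems.TaylorModelReadout

namespace CertificateGlueOn

variable {m : ℕ} {𝕊 : Finset (ℤ × ℤ × ℤ)} {ε₀ : ℝ} {α : Fin m → Fin m → Fin m → ℤ × ℤ × ℤ → ℝ} {Kb Ka : ℤ}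
  {Eb Et : ℝ} {ω : Fin m → ℤ → ℝ}

/-- Per-component weighted coordinates of a cascade state on `Fin (m·W)`: `d ↦ z i k / ω i k` through
`finProdFinEquiv`. [folklore] -/
def pxcoord (Kb Ka : ℤ) (ω : Fin m → ℤ → ℝ) (z : Fin m → ℤ → ℝ) : Fin (m * winLen Kb Ka) → ℝ :=
  fun d => pwcoord Kb Ka ω z (finProdFinEquiv.symm d)

/-- PARALLELEPIPED NODE SET in per-component weighted window coordinates: `x_z = x + C ξ + e`, `|ξ| ≤ r`, `|e| ≤ E`.
[cite: Zgliczynski2002C1Lohner, §3–4 (Lohner-type parallelepiped frames)] -/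
def PInPara (Kb Ka : ℤ) (ω : Fin m → ℤ → ℝ) (x : Fin (m * winLen Kb Ka) → ℝ)
    (C : Matrix (Fin (m * winLen Kb Ka)) (Fin (m * winLen Kb Ka)) ℝ) (r : Fin (m * winLen Kb Ka) → ℝ) (E : ℝ)
    (z : Fin m → ℤ → ℝ) : Prop :=
  ∃ ξ e : Fin (m * winLen Kb Ka) → ℝ, (∀ c, |ξ c| ≤ r c) ∧ (∀ c, |e c| ≤ E) ∧
    pxcoord Kb Ka ω z = x + (C.mulVec ξ + e)

/-- Fattening a parallelepiped by `A·ω` (componentwise on the window) enlarges only its remainder radius. [folklore] -/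
theorem pinPara_of_near (hω : ∀ i k, 0 < ω i k) (hKK : 0 ≤ Ka + Kb + 1) {x : Fin (m * winLen Kb Ka) → ℝ}
    {C : Matrix (Fin (m * winLen Kb Ka)) (Fin (m * winLen Kb Ka)) ℝ} {r : Fin (m * winLen Kb Ka) → ℝ} {E A : ℝ}
    {y p : Fin m → ℤ → ℝ} (hp : PInPara Kb Ka ω x C r E p)
    (hnear : ∀ i k, -Kb ≤ k → k ≤ Ka → |y i k - p i k| ≤ A * ω i k) : PInPara Kb Ka ω x C r (E + A) y := by
  obtain ⟨ξ, e, hξ, he, hpe⟩ := hp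
  refine ⟨ξ, e + (pxcoord Kb Ka ω y - pxcoord Kb Ka ω p), hξ, fun d => ?_, ?_⟩
  · have hd : |(pxcoord Kb Ka ω y - pxcoord Kb Ka ω p) d| ≤ A := by
      simp only [Pi.sub_apply, pxcoord]
      obtain ⟨h1, h2⟩ := shellAt_mem hKK (finProdFinEquiv.symm d).2
      unfold pwcoord
      rw [← sub_div, abs_div, abs_of_pos (hω _ _), div_le_iff₀ (hω _ _)]
      exact hnear _ _ h1 h2
    calc |(e + (pxcoord Kb Ka ω y - pxcoord Kb Ka ω p)) d| ≤ |e d| + |(pxcoord Kb Ka ω y - pxcoord Kb Ka ω p) d| :=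
          abs_add_le _ _
      _ ≤ E + A := add_le_add (he d) hd
  · rw [← add_assoc, ← add_assoc, ← (show x + (C.mulVec ξ + e) = x + C.mulVec ξ + e by abel), ← hpe]
    abel

/-- The common core of glue XIX-c: from the existence half of glue XVIII and ANY landing statement for the coordinate
solutions, the exact-flow step in cascade form required by glue XIV-c (start, window equations, majorant tube,
landing). [cite: Zgliczynski2002C1Lohner, §3–4 (Lohner-type parallelepiped frames and the C¹/variational enclosure); cell certificate format, Lohner step] -/
theorem plohner_flow (hKb : 0 ≤ Kb) (hKa : 1 ≤ Ka) (hε : 0 < 1 + ε₀) (hω : ∀ i k, 0 < ω i k)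
    {h b mC ρC E₀ : ℝ} {x : Fin (m * winLen Kb Ka) → ℝ}
    {C : Matrix (Fin (m * winLen Kb Ka)) (Fin (m * winLen Kb Ka)) ℝ} {r : Fin (m * winLen Kb Ka) → ℝ}
    {Land : (Fin m → ℤ → ℝ) → Prop}
    (hb : 0 ≤ b) (hmC : 0 ≤ mC) (hρC : 0 ≤ ρC) (hE₀ : 0 ≤ E₀) (hh : 0 ≤ h) (hguard : b * (mC + (ρC + E₀)) * h < 1)
    (hB : ∀ i k, -Kb ≤ k → k ≤ Ka →
      ∑ i₁ : Fin m, ∑ i₂ : Fin m, ∑ μ ∈ 𝕊,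
        |α i₁ i₂ i μ| * (1 + ε₀) ^ ((5 : ℝ) * (k - μ.2.2) / 2) *
          (pwExt Kb Ka ω i₁ (k - μ.2.2 + μ.1) * pwExt Kb Ka ω i₂ (k - μ.2.2 + μ.2.1)) ≤ b * ω i k)
    (hx : ∀ c, |x c| ≤ mC)
    (hC : ∀ ξ : Fin (m * winLen Kb Ka) → ℝ, (∀ c, |ξ c| ≤ r c) → ∀ c, |C.mulVec ξ c| ≤ ρC)
    (hland : ∀ (ξ e : Fin (m * winLen Kb Ka) → ℝ), (∀ c, |ξ c| ≤ r c) → (∀ c, |e c| ≤ E₀) →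
      ∀ ψ : ℝ → Fin (m * winLen Kb Ka) → ℝ, ψ 0 = x + (C.mulVec ξ + e) →
        (∀ s ∈ Icc 0 h, HasDerivWithinAt ψ (PQcN 𝕊 ε₀ α Kb Ka ω (ψ s) (ψ s)) (Icc 0 h) s) →
          Land (pwstate Kb Ka ω ((ψ h) ∘ finProdFinEquiv))) :
    ∀ z : Fin m → ℤ → ℝ, PInPara Kb Ka ω x C r E₀ z → ∃ ψ : Fin m → ℤ → ℝ → ℝ,
      (∀ i k, -Kb ≤ k → k ≤ Ka → ψ i k 0 = z i k) ∧
      (∀ i k, -Kb ≤ k → k ≤ Ka → ∀ u ∈ Icc 0 h,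
        HasDerivWithinAt (ψ i k) (truncField 𝕊 ε₀ α Kb Ka (slice ψ u) i k) (Icc 0 h) u) ∧
      (∀ u ∈ Icc 0 h, (fun (_ : ℝ) (q : Fin m → ℤ → ℝ) => ∀ i k, -Kb ≤ k → k ≤ Ka →
        |q i k| ≤ (mC + (ρC + E₀)) / (1 - b * (mC + (ρC + E₀)) * h) * ω i k) u (slice ψ u)) ∧
      Land (slice ψ h) := by
  have hKK : 0 ≤ Ka + Kb + 1 := by omega
  set ρ := ρC + E₀ with hρdef
  have hρ0 : 0 ≤ ρ := by positivity
  set Rh := (mC + ρ) / (1 - b * (mC + ρ) * h) with hRh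
  have hden : 0 < 1 - b * (mC + ρ) * h := by linarith
  set Q := PQcN 𝕊 ε₀ α Kb Ka ω with hQ
  have hBQ := pqcN_bound_of_table (𝕊 := 𝕊) (ε₀ := ε₀) (α := α) hε hω hKK hB
  have hQl : ∀ u, IsLinearMap ℝ (Q u) := isLinearMap_PQcN_right
  have hQr : ∀ v, IsLinearMap ℝ (fun u => Q u v) := isLinearMap_PQcN_left
  have hmaj : ∀ u ∈ Icc 0 h, (mC + ρ) / (1 - b * (mC + ρ) * u) ≤ Rh := by
    intro u hu
    exact div_le_div_of_nonneg_left (by positivity) hden (by nlinarith [mul_nonneg hb (add_nonneg hmC hρ0), hu.2])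
  intro z hz
  obtain ⟨ξ, e, hξ, he, hze⟩ := hz
  set v := C.mulVec ξ + e with hvdef
  have hv : ∀ c, |v c| ≤ ρ := fun c => (abs_add_le _ _).trans (add_le_add (hC ξ hξ c) (he c))
  obtain ⟨ψ, hψ0, hψd, hψb⟩ := lohner_exists hQl hQr hb hBQ hh hmC hρ0 hx hguard v hv
  have hstart : (ψ 0) ∘ finProdFinEquiv = pwcoord Kb Ka ω z := by
    rw [hψ0, ← hze]; funext c; simp [pxcoord]
  refine ⟨fun i k u => pwstate Kb Ka ω ((ψ u) ∘ finProdFinEquiv) i k, fun i k hk1 hk2 => ?_,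
    fun i k hk1 hk2 u hu => ?_, fun u hu i k hk1 hk2 => ?_, ?_⟩
  · -- start
    show pwstate Kb Ka ω ((ψ 0) ∘ finProdFinEquiv) i k = z i k
    rw [hstart, pwstate_pwcoord hω z i hk1 hk2]
  · -- the window equation
    have hlt : (k + Kb).toNat < winLen Kb Ka := by
      unfold winLen; rw [Int.toNat_lt_toNat (by omega)]; omega
    set c : Fin (winLen Kb Ka) := ⟨(k + Kb).toNat, hlt⟩ with hc
    have hsh : shellAt Kb c = k := by
      simp only [shellAt, hc]; rw [Int.toNat_of_nonneg (by omega)]; ring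
    have hfun : (fun u => pwstate Kb Ka ω ((ψ u) ∘ finProdFinEquiv) i k) =
        fun u => ω i k * ψ u (finProdFinEquiv (i, c)) := by
      funext u
      have := pwstate_on (ω := ω) ((ψ u) ∘ finProdFinEquiv) hKK i c
      rw [hsh] at this
      simpa using this
    dsimp only
    rw [hfun]
    have hd := (hasDerivWithinAt_pi.1 (hψd u hu) (finProdFinEquiv (i, c))).const_mul (ω i k)
    refine hd.congr_deriv ?_
    have hslice : slice (fun i k u => pwstate Kb Ka ω ((ψ u) ∘ finProdFinEquiv) i k) u =
        pwstate Kb Ka ω ((ψ u) ∘ finProdFinEquiv) := by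
      funext i' k'; rfl
    rw [hslice, truncField_eq_biFieldOn]
    have hQapp : Q (ψ u) (ψ u) (finProdFinEquiv (i, c)) =
        biFieldOn 𝕊 ε₀ α Kb Ka (pwstate Kb Ka ω ((ψ u) ∘ finProdFinEquiv))
          (pwstate Kb Ka ω ((ψ u) ∘ finProdFinEquiv)) i k / ω i k := by
      simp only [hQ, PQcN, PQc, Equiv.symm_apply_apply, pwcoord]
      rw [hsh]
    rw [hQapp]
    field_simp [(hω i k).ne']
  · -- the majorant tube
    have hlt : (k + Kb).toNat < winLen Kb Ka := by
      unfold winLen; rw [Int.toNat_lt_toNat (by omega)]; omega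
    set c : Fin (winLen Kb Ka) := ⟨(k + Kb).toNat, hlt⟩ with hc
    have hsh : shellAt Kb c = k := by
      simp only [shellAt, hc]; rw [Int.toNat_of_nonneg (by omega)]; ring
    have hvb := hψb u hu (finProdFinEquiv (i, c))
    have := pwstate_on (ω := ω) ((ψ u) ∘ finProdFinEquiv) hKK i c
    rw [hsh] at this
    simp only [slice_apply]
    rw [this, abs_mul, abs_of_pos (hω i k), mul_comm]
    exact mul_le_mul_of_nonneg_right ((by simpa using hvb : |ψ u (finProdFinEquiv (i, c))| ≤ _).trans
      (hmaj u hu)) (hω i k).le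
  · -- landing
    have hsl : slice (fun i k u => pwstate Kb Ka ω ((ψ u) ∘ finProdFinEquiv) i k) h =
        pwstate Kb Ka ω ((ψ h) ∘ finProdFinEquiv) := by funext i' k'; rfl
    rw [hsl]
    exact hland ξ e hξ he ψ hψ0 hψd

/-- Landing in a coordinate parallelepiped, stated on cascade states. [folklore] -/
theorem pinPara_of_coords (hω : ∀ i k, 0 < ω i k) (hKK : 0 ≤ Ka + Kb + 1) {x' : Fin (m * winLen Kb Ka) → ℝ}
    {Cn : Matrix (Fin (m * winLen Kb Ka)) (Fin (m * winLen Kb Ka)) ℝ} {r' : Fin (m * winLen Kb Ka) → ℝ} {E₁ : ℝ}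
    {w : Fin (m * winLen Kb Ka) → ℝ}
    (hw : ∃ ξ' e' : Fin (m * winLen Kb Ka) → ℝ, (∀ c, |ξ' c| ≤ r' c) ∧ (∀ c, |e' c| ≤ E₁) ∧
      w = x' + (Cn.mulVec ξ' + e')) :
    PInPara Kb Ka ω x' Cn r' E₁ (pwstate Kb Ka ω (w ∘ finProdFinEquiv)) := by
  obtain ⟨ξ', e', hξ', he', hwe⟩ := hw
  refine ⟨ξ', e', hξ', he', ?_⟩
  rw [← hwe]
  funext d
  simp only [pxcoord, pwcoord_pwstate hω hKK, Function.comp_apply, Equiv.apply_symm_apply]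

/-- **`StepCert` FROM A LOHNER-CHAIN CERTIFICATE STEP, PER-COMPONENT WEIGHTS** (glue XIX with `ω : Fin m → ℤ → ℝ`;
see the module docstring). [cite: Zgliczynski2002C1Lohner, §3–4 (Lohner-type parallelepiped frames and the C¹/variational enclosure); cell certificate format, Lohner step] -/
theorem stepCert_of_plohner (hKb : 0 ≤ Kb) (hKa : 1 ≤ Ka) (hε : 0 < 1 + ε₀) (hω : ∀ i k, 0 < ω i k)
    {M : ℤ → ℝ} {t : ℕ → ℝ} {Node Hull : ℕ → (Fin m → ℤ → ℝ) → Prop} {j p : ℕ}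
    {b mC ρC E₀ E₁ dP NVh R δ A : ℝ} {x x' : Fin (m * winLen Kb Ka) → ℝ}
    {C Cn Cin : Matrix (Fin (m * winLen Kb Ka)) (Fin (m * winLen Kb Ka)) ℝ} {r r' : Fin (m * winLen Kb Ka) → ℝ}
    (hb : 0 ≤ b) (hmC : 0 ≤ mC) (hρC : 0 ≤ ρC) (hE₀ : 0 ≤ E₀) (hδ : 0 ≤ δ)
    (hh : 0 ≤ t (j + 1) - t j) (hguard : b * (mC + (ρC + E₀)) * (t (j + 1) - t j) < 1)
    (hB : ∀ i k, -Kb ≤ k → k ≤ Ka →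
      ∑ i₁ : Fin m, ∑ i₂ : Fin m, ∑ μ ∈ 𝕊,
        |α i₁ i₂ i μ| * (1 + ε₀) ^ ((5 : ℝ) * (k - μ.2.2) / 2) *
          (pwExt Kb Ka ω i₁ (k - μ.2.2 + μ.1) * pwExt Kb Ka ω i₂ (k - μ.2.2 + μ.2.1)) ≤ b * ω i k)
    (hx : ∀ c, |x c| ≤ mC)
    (hC : ∀ ξ : Fin (m * winLen Kb Ka) → ℝ, (∀ c, |ξ c| ≤ r c) → ∀ c, |C.mulVec ξ c| ≤ ρC)
    (hdP : ∀ c, |TPoly (PQcN 𝕊 ε₀ α Kb Ka ω) p x (t (j + 1) - t j) c - x' c| ≤ dP)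
    (hNVh : ∀ (v : Fin (m * winLen Kb Ka) → ℝ) (N : ℝ), 0 ≤ N → (∀ c, |v c| ≤ N) →
      ∀ c, |VPoly (PQcN 𝕊 ε₀ α Kb Ka ω) p x v (t (j + 1) - t j) c| ≤ NVh * N)
    (hframe : ∀ ξ : Fin (m * winLen Kb Ka) → ℝ, (∀ c, |ξ c| ≤ r c) →
      ∀ c, |Cin.mulVec (VPoly (PQcN 𝕊 ε₀ α Kb Ka ω) p x (C.mulVec ξ) (t (j + 1) - t j)) c| ≤ r' c)
    (hinv : Cn * Cin = 1)
    (hE₁ : dP + NVh * E₀ + mC * (b * mC * (t (j + 1) - t j)) ^ (p + 1) / (1 - b * mC * (t (j + 1) - t j)) +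
      (ρC + E₀) * ((((p : ℝ) + 2) * (b * mC * (t (j + 1) - t j)) ^ (p + 1) -
        ((p : ℝ) + 1) * (b * mC * (t (j + 1) - t j)) ^ (p + 2)) / (1 - b * mC * (t (j + 1) - t j)) ^ 2) +
      ((mC + (ρC + E₀)) / (1 - b * (mC + (ρC + E₀)) * (t (j + 1) - t j)) - mC / (1 - b * mC * (t (j + 1) - t j)) -
        (ρC + E₀) / (1 - b * mC * (t (j + 1) - t j)) ^ 2) ≤ E₁)
    (hR : (mC + (ρC + E₀)) / (1 - b * (mC + (ρC + E₀)) * (t (j + 1) - t j)) ≤ R)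
    (hMR : ∀ i k, -Kb ≤ k → k ≤ Ka → M k ≤ R * ω i k)
    (hdef : PInputDefectOn 𝕊 ε₀ α Kb Ka Eb Et ω (fun i k => -(R * ω i k)) (fun i k => R * ω i k) δ)
    (hA : gronwallBound 0 (2 * b * R) δ (t (j + 1) - t j) ≤ A)
    (hN : ∀ y, Node j y → PInPara Kb Ka ω x C r E₀ y)
    (hH : ∀ y : Fin m → ℤ → ℝ, (∀ i k, -Kb ≤ k → k ≤ Ka →
      |y i k| ≤ ((mC + (ρC + E₀)) / (1 - b * (mC + (ρC + E₀)) * (t (j + 1) - t j)) + A) * ω i k) → Hull j y)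
    (hN' : ∀ y, PInPara Kb Ka ω x' Cn r' (E₁ + A) y → Node (j + 1) y) :
    StepCert 𝕊 ε₀ α Kb Ka Eb Et M t Node Hull j := by
  have hKK : 0 ≤ Ka + Kb + 1 := by omega
  set h := t (j + 1) - t j with hhdef
  set ρ := ρC + E₀ with hρdef
  have hρ0 : 0 ≤ ρ := by positivity
  set Rh := (mC + ρ) / (1 - b * (mC + ρ) * h) with hRh
  have hden : 0 < 1 - b * (mC + ρ) * h := by linarith
  have hRh0 : 0 ≤ Rh := div_nonneg (by positivity) hden.le
  have hR0 : 0 ≤ R := hRh0.trans hR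
  have hBQ := pqcN_bound_of_table (𝕊 := 𝕊) (ε₀ := ε₀) (α := α) hε hω hKK hB
  have hflow := plohner_flow (𝕊 := 𝕊) (ε₀ := ε₀) (α := α) (Land := PInPara Kb Ka ω x' Cn r' E₁) hKb hKa hε hω
    hb hmC hρC hE₀ hh hguard hB hx hC (fun ξ e hξ he ψ hψ0 hψd => pinPara_of_coords hω hKK
      (lohner_land isLinearMap_PQcN_right isLinearMap_PQcN_left hb hBQ hh hmC hρC hE₀ hx hguard hC hdP hNVh
        hframe hinv hE₁ ξ e hξ he ψ hψ0 hψd))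
  refine stepCert_of_flowTube (Start := PInPara Kb Ka ω x C r E₀) (Land := PInPara Kb Ka ω x' Cn r' E₁)
    (Tube := fun (_ : ℝ) (q : Fin m → ℤ → ℝ) => ∀ i k, -Kb ≤ k → k ≤ Ka → |q i k| ≤ Rh * ω i k)
    (glo := fun i k => -(R * ω i k)) (ghi := fun i k => R * ω i k)
    hKb hKa hω (by positivity : 0 ≤ 2 * b * R) hδ hN (fun i k hk1 hk2 => ?_) (fun u _ q hq i k hk1 hk2 => ?_)
    (pfieldLipOn_ball hε hω hR0 hB) hdef hflow hA (fun u _ y q hq hnear => hH y fun i k hk1 hk2 => ?_)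
    (fun y q hq hnear => hN' y (pinPara_of_near hω hKK hq hnear))
  · have := hMR i k hk1 hk2
    exact ⟨by linarith, this⟩
  · have h1 := abs_le.mp (hq i k hk1 hk2)
    have h2 : Rh * ω i k ≤ R * ω i k := mul_le_mul_of_nonneg_right hR (hω i k).le
    exact ⟨by linarith [h1.1], by linarith [h1.2]⟩
  · have h1 := hq i k hk1 hk2
    have h2 := abs_le.mp (hnear i k hk1 hk2)
    rw [abs_le] at h1 ⊢
    constructor <;> nlinarith [h1.1, h1.2, h2.1, h2.2, (hω i k).le]

/-- **`StepCert` FROM A LOHNER-CHAIN CERTIFICATE STEP WITH AN APPROXIMATE FRAME INVERSE, PER-COMPONENT WEIGHTS**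
(glue XIX-b with `ω : Fin m → ℤ → ℝ`: the defect `κI` of `C' C'⁻¹` on the transported vectors enters the E-recursion).
[cite: Zgliczynski2002C1Lohner, §3–4 (Lohner-type parallelepiped frames and the C¹/variational enclosure); cell certificate format, Lohner step] -/
theorem stepCert_of_plohner_approx (hKb : 0 ≤ Kb) (hKa : 1 ≤ Ka) (hε : 0 < 1 + ε₀) (hω : ∀ i k, 0 < ω i k)
    {M : ℤ → ℝ} {t : ℕ → ℝ} {Node Hull : ℕ → (Fin m → ℤ → ℝ) → Prop} {j p : ℕ}
    {b mC ρC E₀ E₁ dP NVh κI R δ A : ℝ} {x x' : Fin (m * winLen Kb Ka) → ℝ}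
    {C Cn Cin : Matrix (Fin (m * winLen Kb Ka)) (Fin (m * winLen Kb Ka)) ℝ} {r r' : Fin (m * winLen Kb Ka) → ℝ}
    (hb : 0 ≤ b) (hmC : 0 ≤ mC) (hρC : 0 ≤ ρC) (hE₀ : 0 ≤ E₀) (hδ : 0 ≤ δ)
    (hh : 0 ≤ t (j + 1) - t j) (hguard : b * (mC + (ρC + E₀)) * (t (j + 1) - t j) < 1)
    (hB : ∀ i k, -Kb ≤ k → k ≤ Ka →
      ∑ i₁ : Fin m, ∑ i₂ : Fin m, ∑ μ ∈ 𝕊,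
        |α i₁ i₂ i μ| * (1 + ε₀) ^ ((5 : ℝ) * (k - μ.2.2) / 2) *
          (pwExt Kb Ka ω i₁ (k - μ.2.2 + μ.1) * pwExt Kb Ka ω i₂ (k - μ.2.2 + μ.2.1)) ≤ b * ω i k)
    (hx : ∀ c, |x c| ≤ mC)
    (hC : ∀ ξ : Fin (m * winLen Kb Ka) → ℝ, (∀ c, |ξ c| ≤ r c) → ∀ c, |C.mulVec ξ c| ≤ ρC)
    (hdP : ∀ c, |TPoly (PQcN 𝕊 ε₀ α Kb Ka ω) p x (t (j + 1) - t j) c - x' c| ≤ dP)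
    (hNVh : ∀ (v : Fin (m * winLen Kb Ka) → ℝ) (N : ℝ), 0 ≤ N → (∀ c, |v c| ≤ N) →
      ∀ c, |VPoly (PQcN 𝕊 ε₀ α Kb Ka ω) p x v (t (j + 1) - t j) c| ≤ NVh * N)
    (hframe : ∀ ξ : Fin (m * winLen Kb Ka) → ℝ, (∀ c, |ξ c| ≤ r c) →
      ∀ c, |Cin.mulVec (VPoly (PQcN 𝕊 ε₀ α Kb Ka ω) p x (C.mulVec ξ) (t (j + 1) - t j)) c| ≤ r' c)
    (hinv : ∀ ξ : Fin (m * winLen Kb Ka) → ℝ, (∀ c, |ξ c| ≤ r c) → ∀ c,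
      |(Cn.mulVec (Cin.mulVec (VPoly (PQcN 𝕊 ε₀ α Kb Ka ω) p x (C.mulVec ξ) (t (j + 1) - t j))) -
        VPoly (PQcN 𝕊 ε₀ α Kb Ka ω) p x (C.mulVec ξ) (t (j + 1) - t j)) c| ≤ κI)
    (hE₁ : κI + dP + NVh * E₀ + mC * (b * mC * (t (j + 1) - t j)) ^ (p + 1) / (1 - b * mC * (t (j + 1) - t j)) +
      (ρC + E₀) * ((((p : ℝ) + 2) * (b * mC * (t (j + 1) - t j)) ^ (p + 1) -
        ((p : ℝ) + 1) * (b * mC * (t (j + 1) - t j)) ^ (p + 2)) / (1 - b * mC * (t (j + 1) - t j)) ^ 2) +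
      ((mC + (ρC + E₀)) / (1 - b * (mC + (ρC + E₀)) * (t (j + 1) - t j)) - mC / (1 - b * mC * (t (j + 1) - t j)) -
        (ρC + E₀) / (1 - b * mC * (t (j + 1) - t j)) ^ 2) ≤ E₁)
    (hR : (mC + (ρC + E₀)) / (1 - b * (mC + (ρC + E₀)) * (t (j + 1) - t j)) ≤ R)
    (hMR : ∀ i k, -Kb ≤ k → k ≤ Ka → M k ≤ R * ω i k)
    (hdef : PInputDefectOn 𝕊 ε₀ α Kb Ka Eb Et ω (fun i k => -(R * ω i k)) (fun i k => R * ω i k) δ)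
    (hA : gronwallBound 0 (2 * b * R) δ (t (j + 1) - t j) ≤ A)
    (hN : ∀ y, Node j y → PInPara Kb Ka ω x C r E₀ y)
    (hH : ∀ y : Fin m → ℤ → ℝ, (∀ i k, -Kb ≤ k → k ≤ Ka →
      |y i k| ≤ ((mC + (ρC + E₀)) / (1 - b * (mC + (ρC + E₀)) * (t (j + 1) - t j)) + A) * ω i k) → Hull j y)
    (hN' : ∀ y, PInPara Kb Ka ω x' Cn r' (E₁ + A) y → Node (j + 1) y) :
    StepCert 𝕊 ε₀ α Kb Ka Eb Et M t Node Hull j := by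
  have hKK : 0 ≤ Ka + Kb + 1 := by omega
  set h := t (j + 1) - t j with hhdef
  set ρ := ρC + E₀ with hρdef
  have hρ0 : 0 ≤ ρ := by positivity
  set Rh := (mC + ρ) / (1 - b * (mC + ρ) * h) with hRh
  have hden : 0 < 1 - b * (mC + ρ) * h := by linarith
  have hRh0 : 0 ≤ Rh := div_nonneg (by positivity) hden.le
  have hR0 : 0 ≤ R := hRh0.trans hR
  have hBQ := pqcN_bound_of_table (𝕊 := 𝕊) (ε₀ := ε₀) (α := α) hε hω hKK hB
  have hflow := plohner_flow (𝕊 := 𝕊) (ε₀ := ε₀) (α := α) (Land := PInPara Kb Ka ω x' Cn r' E₁) hKb hKa hε hω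
    hb hmC hρC hE₀ hh hguard hB hx hC (fun ξ e hξ he ψ hψ0 hψd => pinPara_of_coords hω hKK
      (lohner_land_approx isLinearMap_PQcN_right isLinearMap_PQcN_left hb hBQ hh hmC hρC hE₀ hx hguard hC hdP
        hNVh hframe hinv hE₁ ξ e hξ he ψ hψ0 hψd))
  refine stepCert_of_flowTube (Start := PInPara Kb Ka ω x C r E₀) (Land := PInPara Kb Ka ω x' Cn r' E₁)
    (Tube := fun (_ : ℝ) (q : Fin m → ℤ → ℝ) => ∀ i k, -Kb ≤ k → k ≤ Ka → |q i k| ≤ Rh * ω i k)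
    (glo := fun i k => -(R * ω i k)) (ghi := fun i k => R * ω i k)
    hKb hKa hω (by positivity : 0 ≤ 2 * b * R) hδ hN (fun i k hk1 hk2 => ?_) (fun u _ q hq i k hk1 hk2 => ?_)
    (pfieldLipOn_ball hε hω hR0 hB) hdef hflow hA (fun u _ y q hq hnear => hH y fun i k hk1 hk2 => ?_)
    (fun y q hq hnear => hN' y (pinPara_of_near hω hKK hq hnear))
  · have := hMR i k hk1 hk2
    exact ⟨by linarith, this⟩
  · have h1 := abs_le.mp (hq i k hk1 hk2)
    have h2 : Rh * ω i k ≤ R * ω i k := mul_le_mul_of_nonneg_right hR (hω i k).le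
    exact ⟨by linarith [h1.1], by linarith [h1.2]⟩
  · have h1 := hq i k hk1 hk2
    have h2 := abs_le.mp (hnear i k hk1 hk2)
    rw [abs_le] at h1 ⊢
    constructor <;> nlinarith [h1.1, h1.2, h2.1, h2.2, (hω i k).le]

end CertificateGlueOn

end Summit.NavierStokesRegularity.NavierStokesRegularity.Theorems

end
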